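import Summits.BirchSwinnertonDyer.Rank1Residual.Supersingular.DescentLowerBound
import Summits.BirchSwinnertonDyer.Rank1Residual.Supersingular.RankOneRem13RecordShapesCount
import HarnessLib

/-!
# Route `SignedLowerHalves`, crux `KobayashiLowerHalfLargeImage` (item stmt-BirchSwinnertonDyer-19001), its
# rank-0 cells at `p = 3` PER PAIR: the record SHAPE «literal model + `Sel^(3)(E/ℚ) ≠ 0` ⇒ `BSD(E,3)`» on X7 ∩
# {surj(3)} at `ord₃ #Ш_an ≤ 2` from PUBLISHED facts (cell `bsd-ssimc`, seat `bsd-ssimc-k3-c5` gen 5 for the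
# unseated row k3-c3; a `--supports … --as helper` file; closes nothing about the crux)

PARTITION (cell bsd-ssimc): X7 (A7) × the `r_an = 0 ∧ surj(3)` classes at `p = 3` with `ord₃ #Ш_an = 2` (23 of the
34 A7 r0 classes at `3`) — closes PER PAIR only (through the records that instantiate this shape; OFFERS, the
desk books); types nothing new; crux 3
(`Summit.BirchSwinnertonDyer.BirchSwinnertonDyer.Theses.SignedLowerHalves.KobayashiLowerHalfLargeImage`) stays OPEN
(closed BY NAME only modulo the Fouquet–Wan PRE binder, k3-c3 p431969). HONEST FRAMING: BSD
is not proved by any of this; nothing here is new mathematics; THEOREMS ONLY (no definition, no named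
fact, no `sorry`).

## What this file does

The X7 twin of `…SprungLowerHalfAtThreeSelmerNineShape.lean` (p439631). The tree already holds, from cell
`b2b-bsdres`: the PUBLISHED-facts per-pair consumer
`Supersingular.X7.bsdp_rankZero_of_casselsTate_of_selmerGroup_ne_bot_of_surj` (`DescentLowerBound.lean`: on an X7
pair at an odd good supersingular `p` with `r_an = 0`, `ρ̄_{E,p}` onto, `#Ш_an = q`, `ord_p q ≤ 2` and
`Sel^(p)(E/ℚ) ≠ 0`: `BSD(E,p)` — GZK gives rank `0` and `Ш` finite; `E[p]` irreducible (`ClassX7.irr`) kills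
`p`-torsion, so `Sel^(p) ↪ Ш[p]` is non-zero ⇒ `p ∣ #Ш` ⇒ `p² ∣ #Ш` by Cassels–Tate ⇒ `MissingLowerBoundAt W p`;
upper half Wuthrich 2014 Prop. 21 + modularity), the two-engine exact `3`-descent rows `dim_𝔽₃ Sel^(3)(E/ℚ) = 2`
for all 23 X7 ∩ {r_an = 0} ∩ {#Ш_an = 9} classes with `N < 2·10⁴` (`Supersingular/X678DescentRecords.lean`,
`checked_x7_rankZero_sha9_desc3…`, kit j091546) and the kernel certificates `surj_x7r0_<label>_3`
(`RankZeroSurjThreeCertificates_04/05`). This file supplies the glue READ OFF A LITERAL MODEL `⟨a₁,…,a₆⟩`: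
global minimality as a hypothesis, `3 ∤ Δ`, the schema point count `countPoints [a₁,…,a₆] 3 = n₃` with
`3 ∣ 4 − n₃` (`a_3 = 0`), an additive prime `q` (`q ∣ Δ`, `q ∣ c₄`: NOT semistable; `classX7_of_intModel`), the
surjectivity certificate, and the displayed per-pair lines — exactly the hypothesis handling of
`Supersingular.X7.bsdp_three_rankZero_of_kim2025_OPEN_of_ainvs_of_certifiedOddL_of_LValueBall` (the K25 offer
shape), with NO OPEN binder. The 23 records `X7.bsdp3_sel9_<label>` live in `…LargeImageSelmerNineRecords{A,B}.lean`.

References: [Wuthrich2014] Prop. 21; [SilvermanAEC2009] Thm. X.4.14, X.4.2(a), VII.5 Prop. 5.1(a);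
[Serre1972] §1.11 Prop. 12; [Miller2011LMS] Def. 1.1; [IrelandRosen1990] Prop. 5.1.2, §8.1.
-/

set_option autoImplicit false
set_option linter.dupNamespace false

noncomputable section

open scoped Classical

open WeierstrassCurve Literature.NumberTheory.EllipticCurves
  Literature.NumberTheory.EllipticCurves.Rank1Residual
  Literature.NumberTheory.EllipticCurves.Rank1Residual.Typed
  Literature.NumberTheory.EllipticCurves.Rank1Residual.X11RankOneCertificates
  Literature.NumberTheory.EllipticCurves.Wuthrich2014
  Summit.BirchSwinnertonDyer.BirchSwinnertonDyer.Rank1Residual.IntModel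
  Summit.BirchSwinnertonDyer.BirchSwinnertonDyer.Rank1Residual.X11RankOne
  Summit.BirchSwinnertonDyer.Rank1Residual.X11b
  Summit.BirchSwinnertonDyer.Rank1Residual.Supersingular

namespace Summit.BirchSwinnertonDyer.BirchSwinnertonDyer.Theorems

/-- **RECORD SHAPE — X7 ∩ {r_an = 0} ∩ {surj(3)}, literal model, `ord₃ #Ш_an ≤ 2`: `BSD(E,3)` from
PUBLISHED named facts + the native `3`-descent line `Sel^(3)(E/ℚ) ≠ 0`.** Inputs by name: Cassels–Tate
(`hCT`), Wuthrich 2014 Prop. 21 (`hW`), GZK (`hGZK`), modularity (`hmod`); of the literal model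
`⟨a₁,a₂,a₃,a₄,a₆⟩`: global minimality (`hmin`), `3 ∤ Δ` (`h3Δ`), `#Ẽ(𝔽₃) = n₃` with `3 ∣ 4 − n₃` (`hc₃`, `ha₃`:
good supersingular, `a_3 = 0`), an additive prime `q ∣ (Δ, c₄)` (`hq`, `hqΔ`, `hqc₄`: class X7 via
`classX7_of_intModel`), `ρ̄_{E,3}` onto (`hsurj`); per pair: `r_an = 0` (`hr`), `#Ш_an = s` with `ord₃ s ≤ 2`
(`hs`, `hv`) and `Sel^(3)(E/ℚ) ≠ ⊥` (`hSel`, the certificate line). Conclusion =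
`Supersingular.X7.bsdp_rankZero_of_casselsTate_of_selmerGroup_ne_bot_of_surj` on the literal model. Per pair;
class X7 and crux 3 unchanged; nothing booked. [cite: Wuthrich2014, Prop. 21 (p. 400)]
[cite: SilvermanAEC2009, Thm. X.4.14 and VII.5 Prop. 5.1(a),(c)] [cite: Serre1972, §1.11 Prop. 12]
[cite: Miller2011LMS, §1 and Def. 1.1] [cite: IrelandRosen1990, Prop. 5.1.2 and §8.1] -/
theorem X7.bsdp_three_rankZero_of_ainvs_of_selmerGroup_ne_bot_of_surj
    (hCT : exists_casselsTate_pairing (K := ℚ)) (hW : sha_dvd_analyticSha)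
    (hGZK : rank_eq_analyticRank_of_analyticRank_le_one) (hmod : hasEntireLFunction_rat)
    (a1 a2 a3 a4 a6 : ℤ) (hmin : (⟨a1, a2, a3, a4, a6⟩ : WeierstrassCurve ℚ).IsGloballyMinimal)
    (h3Δ : ¬ (3 : ℤ) ∣ discOf [a1, a2, a3, a4, a6]) {n₃ : ℕ}
    (hc₃ : countPoints [a1, a2, a3, a4, a6] 3 = n₃) (ha₃ : (3 : ℤ) ∣ (3 : ℤ) + 1 - n₃)
    (q : ℕ) (hq : q.Prime) (hqΔ : (q : ℤ) ∣ discOf [a1, a2, a3, a4, a6])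
    (hqc₄ : (q : ℤ) ∣ c4Of [a1, a2, a3, a4, a6])
    (hsurj : Surj (⟨a1, a2, a3, a4, a6⟩ : WeierstrassCurve ℚ) 3)
    (hr : (⟨a1, a2, a3, a4, a6⟩ : WeierstrassCurve ℚ).analyticRank = 0)
    {s : ℚ} (hs : shaAn (⟨a1, a2, a3, a4, a6⟩ : WeierstrassCurve ℚ) = (s : ℂ))
    (hv : padicValRat 3 s ≤ 2)
    (hSel : (⟨a1, a2, a3, a4, a6⟩ : WeierstrassCurve ℚ).selmerGroup (3 : ℤ) ≠ ⊥) :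
    BSDp (⟨a1, a2, a3, a4, a6⟩ : WeierstrassCurve ℚ) 3 := by
  have h0 : discOf [a1, a2, a3, a4, a6] ≠ 0 := fun h ↦ h3Δ (by rw [h]; exact dvd_zero _)
  haveI := isElliptic_of_discOf_ne_zero a1 a2 a3 a4 a6 h0
  haveI := hmin
  have hI : integralModelInt (⟨a1, a2, a3, a4, a6⟩ : WeierstrassCurve ℚ) = ⟨a1, a2, a3, a4, a6⟩ :=
    integralModelInt_eq_of_map_eq _ (map_mk_int a1 a2 a3 a4 a6)
  -- class X7 at `3`: `3 ∤ Δ`, `3 ∣ a_3 = 4 − #Ẽ(𝔽₃)`, and the additive prime `q`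
  have hX : ClassX7 (⟨a1, a2, a3, a4, a6⟩ : WeierstrassCurve ℚ) 3 :=
    classX7_of_intModel (p := 3) hI (by rw [intCurve_Δ]; exact h3Δ)
      (natCard_point_eq_of_countPoints a1 a2 a3 a4 a6 3 (by decide) h3Δ hc₃) ha₃ q hq
      (by rw [intCurve_Δ]; exact hqΔ) (by rw [intCurve_c₄]; exact hqc₄)
  exact X7.bsdp_rankZero_of_casselsTate_of_selmerGroup_ne_bot_of_surj _ 3 hCT hW hGZK hmod (by norm_num) hX
    hsurj hr hs hv hSel

end Summit.BirchSwinnertonDyer.BirchSwinnertonDyer.Theorems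

end
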